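import Summits.KontsevichZagierPeriods.KontsevichZagierPeriods.Theorems.HurwitzMicroSectorsNormalFormPrincipleM2FiveZetaTwo
import Literature.NumberTheory.Transcendental.KZProductIdeal
import Literature.NumberTheory.Transcendental.KZSemiCanonicalReductionProofs

/-!
# `NormalFormPrinciple` (stmt-KontsevichZagierPeriods-3869), line `SketchIdeator1` — leaf `stub_boxRigidity`,
# dimension two off the product type (`CatalanTwoWays`, half-angle/Möbius/Catalan side): the Catalan side

Registered sub-goal `catalanBox_triangle_wedge` of the layer `CatalanTwoWays` (lead file `…M2`), the
three shapes of Catalan's constant `G = ∫∫ dx dy/(1 + x²y²)`: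

1. (rule 2, the merge gadget) the band-box representation `C₀ = [{0 < x < 1, 0 ≤ y ≤ 1}, 1/(1 + (xy)²)]`
   and the triangle representation `C₁ = [{0 < x < 1, 0 ≤ z ≤ x}, 1/(x(1 + z²))]` differ by a relation:
   the substitution `z = xy` along the last coordinate over the open base `(0,1)`
   (`KZ.of_sub_of_mem_relations_of_affine` with `α = 0`, `β = x`, Jacobian `x`) carries the band-box
   onto the triangle, and `1/(x(1 + (xy)²)) · x = 1/(1 + (xy)²)`.
2. (rules 2 and 1) the triangle `C₁` and the wedge `K' = [{0 < u < 1, u ≤ y ≤ 1}, 1/((1 + u²)y)]`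
   differ by a relation: the coordinate swap (`KZ.IntegralRep.reindex`,
   `KZ.of_sub_of_reindex_mem_relations`) carries `C₁` to `[{0 < y < 1, 0 ≤ u ≤ y}, 1/(y(1 + u²))]`,
   whose domain differs from the wedge by the two null edges `u = 0`, `y = 1`
   (`KZ.of_sub_of_mem_relations_of_null`).

References: M. Kontsevich, D. Zagier, *Periods* (2001), §1.2 rules (1), (2). No new definitions.
-/

noncomputable section

open MeasureTheory Set
open Literature.NumberTheory.Transcendental Literature.NumberTheory.Transcendental.KZ
open Literature.ModelTheory.ExponentialFields (IsSemialgebraic)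

namespace Summit.KontsevichZagierPeriods.HurwitzMicroSectors.NormalFormPrinciple.PiBox.M2

/-- **The merge gadget for Catalan's constant** (rule 2): the band-box representation
`C₀ = [{0 < x < 1, 0 ≤ y ≤ 1}, 1/(1 + (xy)²)]` and the triangle representation
`C₁ = [{0 < x < 1, 0 ≤ z ≤ x}, 1/(x(1 + z²))]` differ by a relation, the substitution `z = xy` along
the last coordinate (`KZ.of_sub_of_mem_relations_of_affine`, `α = 0`, `β = x`, Jacobian `x`) carrying
the band-box onto the triangle with `1/(x(1 + (xy)²)) · x = 1/(1 + (xy)²)`.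
[cite: KontsevichZagier2001, §1.2 rule (2)] -/
theorem catalanBox_sub_triangle (C₀ C₁ : IntegralRep 2)
    (hC₀d : C₀.domain = KZlog.band {y : Fin 1 → ℝ | 0 < y 0 ∧ y 0 < 1} (fun _ => (0:ℝ)) (fun _ => (1:ℝ)))
    (hC₀i : EqOn C₀.integrand (fun z => 1 / (1 + (z 0 * z 1) ^ 2)) C₀.domain)
    (hC₁d : C₁.domain = KZlog.band {y : Fin 1 → ℝ | 0 < y 0 ∧ y 0 < 1} (fun _ => (0:ℝ)) (fun y => y 0))
    (hC₁i : EqOn C₁.integrand (fun z => 1 / (z 0 * (1 + z 1 ^ 2))) C₁.domain) :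
    of C₀ - of C₁ ∈ relations := by
  have hG : IsSemialgebraic ℚ {y : Fin 1 → ℝ | 0 < y 0 ∧ y 0 < 1} :=
    isSemialgebraic_unitInterval_fin_one
  have hGo : IsOpen {y : Fin 1 → ℝ | 0 < y 0 ∧ y 0 < 1} :=
    isOpen_Ioo.preimage (continuous_apply 0)
  -- the merge identity at a point of the band-box, the substituted point being `(x, 0 + x y)`
  have key : ∀ z ∈ C₀.domain, C₀.integrand z =
      C₁.integrand (Fin.snoc (Fin.init z) (0 + Fin.init z 0 * z (Fin.last 1))) * Fin.init z 0 := by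
    intro z hz
    have hz' := hz
    rw [hC₀d] at hz'
    obtain ⟨hzG, h0, h1⟩ := KZlog.mem_band.1 hz'
    have hx : 0 < Fin.init z 0 ∧ Fin.init z 0 < 1 := hzG
    have h0' : 0 ≤ z (Fin.last 1) := h0
    have h1' : z (Fin.last 1) ≤ 1 := h1
    have hw : (Fin.snoc (Fin.init z) (0 + Fin.init z 0 * z (Fin.last 1)) : Fin 2 → ℝ) ∈
        C₁.domain := by
      rw [hC₁d]
      refine KZlog.mem_band.2 ?_
      rw [Fin.init_snoc, Fin.snoc_last]
      exact ⟨hzG, by nlinarith [mul_nonneg hx.1.le h0'],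
        by nlinarith [mul_le_mul_of_nonneg_left h1' hx.1.le]⟩
    rw [hC₀i hz, hC₁i hw]
    have hx0 : (z 0 : ℝ) ≠ 0 := hx.1.ne'
    show 1 / (1 + (z 0 * z 1) ^ 2) = 1 / (z 0 * (1 + (0 + z 0 * z 1) ^ 2)) * z 0
    rw [zero_add]
    field_simp
  exact of_sub_of_mem_relations_of_affine (m := 1) hGo (α := fun _ => (0:ℝ)) (β := fun y => y 0)
    (a := fun _ => (0:ℝ)) (b := fun _ => (1:ℝ)) (a' := fun _ => (0:ℝ)) (b' := fun y => y 0)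
    (by simpa using isSemialgebraicFunOn_ratCast hG 0) (isSemialgebraicFunOn_apply hG 0)
    (differentiableOn_const 0) (differentiableOn_apply 0 _) (fun y hy => hy.1) C₀ C₁ hC₀d hC₁d
    (fun y _ => by ring) (fun y _ => by ring) key

/-- **Triangle versus wedge for Catalan's constant** (rules 2 and 1): the triangle representation
`C₁ = [{0 < x < 1, 0 ≤ z ≤ x}, 1/(x(1 + z²))]` and the wedge representation
`K' = [{0 < u < 1, u ≤ y ≤ 1}, 1/((1 + u²)y)]` differ by a relation: the coordinate swap
(`KZ.of_sub_of_reindex_mem_relations`) carries `C₁` to `[{0 < y < 1, 0 ≤ u ≤ y}, 1/(y(1 + u²))]`,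
whose domain differs from the wedge by the null edges `u = 0` and `y = 1`, the integrands agreeing on
the overlap (`KZ.of_sub_of_mem_relations_of_null`). [cite: KontsevichZagier2001, §1.2 rules (1), (2)] -/
theorem catalanTriangle_sub_wedge (C₁ K' : IntegralRep 2)
    (hC₁d : C₁.domain = KZlog.band {y : Fin 1 → ℝ | 0 < y 0 ∧ y 0 < 1} (fun _ => (0:ℝ)) (fun y => y 0))
    (hC₁i : EqOn C₁.integrand (fun z => 1 / (z 0 * (1 + z 1 ^ 2))) C₁.domain)
    (hK'd : K'.domain = KZlog.band {y : Fin 1 → ℝ | 0 < y 0 ∧ y 0 < 1} (fun y => y 0) (fun _ => (1:ℝ)))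
    (hK'i : EqOn K'.integrand (fun z => 1 / ((1 + z 0 ^ 2) * z 1)) K'.domain) :
    of C₁ - of K' ∈ relations := by
  -- the swapped triangle `S = [{0 < y < 1, 0 ≤ u ≤ y}, 1/(y(1 + u²))]`
  set S : IntegralRep 2 := C₁.reindex (Equiv.swap (0 : Fin 2) 1) with hS
  have e1 : of C₁ - of S ∈ relations := of_sub_of_reindex_mem_relations C₁ _
  have hsw : ∀ w : Fin 2 → ℝ, (fun i => w (Equiv.swap (0 : Fin 2) 1 i)) ∈ C₁.domain ↔
      (0 < w 1 ∧ w 1 < 1) ∧ 0 ≤ w 0 ∧ w 0 ≤ w 1 := by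
    intro w
    rw [hC₁d, KZlog.mem_band]
    have h0 : (Equiv.swap (0 : Fin 2) 1) 0 = 1 := Equiv.swap_apply_left _ _
    have h1 : (Equiv.swap (0 : Fin 2) 1) 1 = 0 := Equiv.swap_apply_right _ _
    have hi : Fin.init (fun i => w (Equiv.swap (0 : Fin 2) 1 i)) 0 = w 1 := by
      show w (Equiv.swap (0 : Fin 2) 1 0) = w 1
      rw [h0]
    have hl : w (Equiv.swap (0 : Fin 2) 1 (Fin.last 1)) = w 0 := by
      show w (Equiv.swap (0 : Fin 2) 1 1) = w 0
      rw [h1]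
    rw [hl, mem_setOf_eq, hi]
  have hSd : ∀ w : Fin 2 → ℝ, w ∈ S.domain ↔ (0 < w 1 ∧ w 1 < 1) ∧ 0 ≤ w 0 ∧ w 0 ≤ w 1 := by
    intro w
    rw [hS, IntegralRep.reindex_domain, mem_setOf_eq]
    exact hsw w
  have hKd : ∀ w : Fin 2 → ℝ, w ∈ K'.domain ↔ (0 < w 0 ∧ w 0 < 1) ∧ w 0 ≤ w 1 ∧ w 1 ≤ 1 := by
    intro w
    rw [hK'd]
    exact Iff.rfl
  -- the two domains differ by the null edges `u = 0`, `y = 1`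
  have h₁ : volume (S.domain \ K'.domain) = 0 := by
    refine measure_mono_null (fun w hw => ?_)
      (Measure.pi_hyperplane (fun _ => (volume : Measure ℝ)) 0 0)
    have hwS := (hSd w).1 hw.1
    have hwK : ¬ ((0 < w 0 ∧ w 0 < 1) ∧ w 0 ≤ w 1 ∧ w 1 ≤ 1) := fun h => hw.2 ((hKd w).2 h)
    show w 0 = 0
    by_contra h0
    exact hwK ⟨⟨lt_of_le_of_ne hwS.2.1 (Ne.symm h0), by linarith [hwS.1.2, hwS.2.2]⟩, hwS.2.2,
      hwS.1.2.le⟩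
  have h₂ : volume (K'.domain \ S.domain) = 0 := by
    refine measure_mono_null (fun w hw => ?_)
      (Measure.pi_hyperplane (fun _ => (volume : Measure ℝ)) 1 1)
    have hwK := (hKd w).1 hw.1
    have hwS : ¬ ((0 < w 1 ∧ w 1 < 1) ∧ 0 ≤ w 0 ∧ w 0 ≤ w 1) := fun h => hw.2 ((hSd w).2 h)
    show w 1 = 1
    by_contra h1
    exact hwS ⟨⟨by linarith [hwK.1.1, hwK.2.1], lt_of_le_of_ne hwK.2.2 h1⟩, hwK.1.1.le, hwK.2.1⟩
  -- ... and the integrands agree on the overlap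
  have hint : EqOn S.integrand K'.integrand (S.domain ∩ K'.domain) := by
    intro w hw
    have hwC : (fun i => w (Equiv.swap (0 : Fin 2) 1 i)) ∈ C₁.domain := hw.1
    have hwK := (hKd w).1 hw.2
    rw [hK'i hw.2, hS, IntegralRep.reindex_integrand]
    show C₁.integrand (fun i => w (Equiv.swap (0 : Fin 2) 1 i)) = 1 / ((1 + w 0 ^ 2) * w 1)
    rw [hC₁i hwC]
    show 1 / (w (Equiv.swap (0 : Fin 2) 1 0) * (1 + w (Equiv.swap (0 : Fin 2) 1 1) ^ 2)) =
      1 / ((1 + w 0 ^ 2) * w 1)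
    rw [Equiv.swap_apply_left, Equiv.swap_apply_right, mul_comm]
  have e2 : of S - of K' ∈ relations := of_sub_of_mem_relations_of_null S K' h₁ h₂ hint
  have e : of C₁ - of K' = (of C₁ - of S) + (of S - of K') := by abel
  rw [e]
  exact relations.add_mem e1 e2

/-- **Stub (Catalan side: band-box ≡ triangle ≡ wedge)** of the layer `CatalanTwoWays`:
(a) `[{0 < x < 1, 0 ≤ y ≤ 1}, 1/(1 + (xy)²)] − [{0 ≤ z ≤ x}, 1/(x(1 + z²))] ∈ relations` (the merge
gadget `z = xy`, rule 2); (b) `[{0 ≤ z ≤ x}, 1/(x(1 + z²))] − [{u ≤ y ≤ 1}, 1/((1 + u²)y)] ∈ relations`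
(coordinate swap, rule 2, and two null edges, rule 1).
[cite: KontsevichZagier2001, §1.2 rules (1), (2)] -/
theorem catalanBox_triangle_wedge :
    (∀ (C₀ C₁ : IntegralRep 2),
      C₀.domain = KZlog.band {y : Fin 1 → ℝ | 0 < y 0 ∧ y 0 < 1} (fun _ => (0:ℝ)) (fun _ => (1:ℝ)) →
      EqOn C₀.integrand (fun z => 1 / (1 + (z 0 * z 1) ^ 2)) C₀.domain →
      C₁.domain = KZlog.band {y : Fin 1 → ℝ | 0 < y 0 ∧ y 0 < 1} (fun _ => (0:ℝ)) (fun y => y 0) →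
      EqOn C₁.integrand (fun z => 1 / (z 0 * (1 + z 1 ^ 2))) C₁.domain →
      of C₀ - of C₁ ∈ relations) ∧
    (∀ (C₁ K' : IntegralRep 2),
      C₁.domain = KZlog.band {y : Fin 1 → ℝ | 0 < y 0 ∧ y 0 < 1} (fun _ => (0:ℝ)) (fun y => y 0) →
      EqOn C₁.integrand (fun z => 1 / (z 0 * (1 + z 1 ^ 2))) C₁.domain →
      K'.domain = KZlog.band {y : Fin 1 → ℝ | 0 < y 0 ∧ y 0 < 1} (fun y => y 0) (fun _ => (1:ℝ)) →
      EqOn K'.integrand (fun z => 1 / ((1 + z 0 ^ 2) * z 1)) K'.domain →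
      of C₁ - of K' ∈ relations) :=
  ⟨catalanBox_sub_triangle, catalanTriangle_sub_wedge⟩

end Summit.KontsevichZagierPeriods.HurwitzMicroSectors.NormalFormPrinciple.PiBox.M2
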